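import Summits.QuantumFields.YangMills.Theorems.UnitScaleTiltProp8FibreInjective
import Summits.QuantumFields.YangMills.Theorems.UnitScaleTiltProp8IterTangent
import HarnessLib

/-!
# Route `UnitScaleTilt`, crux K1 «MinimiserStabilityRegPr» (stmt-QuantumFields-19200), stub `stub_prop8` (V2) — sub-lemma C_k qualitative, part U2:
# **THE k-FOLD (0.4)-DESCENT FIBRE IS A GRAPH OVER THE BONDS OUTSIDE THE ITERATED CENTRAL BONDS** (`eq_of_iter_eq_of_agree`)

Cell `ym3-torus` ∕ fleet seat `ym-ust-19200-p2` g4.  Part U1 (one step): two small fields with the same (0.4)-average that agree off the central bonds and are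
close on them coincide.  Here the k-fold statement: if `U′` agrees with `U` outside the bottom set `T₀` of a tower with `T_i ⊆ β(T_{i+1})` (the iterated central
bonds `β^k`(top set) and its sub-towers), the iterated averages of `U` are `t`-small, those of `U′` are `ρ`-close to them on the central bonds, and
`Ū′^{(k)} = Ū^{(k)}`, then `U′ = U`.  PROOF: agreement propagates UP the levels off the tower by locality (`avgFun_eq_of_agree_off_image`: if `U′ = U` off
`β(S)` then `Ū′ = Ū` off `S`), and equality propagates DOWN from the top by the one-step uniqueness of part U1.  With the k-fold exact corrector (p518511)
and the tangent curves (p515026) this completes the qualitative chart «C_k» of the V2∕V3 censuses at a fixed lattice: near a small field the k-fold fibre is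
the graph of a map (non-iterated-central bonds) ↦ (iterated central bonds), differentiable along curves, whose multipliers carry the Euler–Lagrange equation
(p516212 ∕ p519004).  Sorry-free, no definition. [folklore] ∕ cited.  References: T. Bałaban, CMP 102 (1985) 277–309 [Balaban1985Variational] ((47)–(48) p.287);
CMP 109 (1987) 249–301 [Balaban1987RG1] ((0.4), (0.11) p.253).
-/

noncomputable section

open scoped BigOperators Matrix.Norms.L2Operator Matrix
open Filter Function

namespace Summit.QuantumFields.YangMills.Theorems.Prop8Criticality

open Literature.MathematicalPhysics.QuantumFieldTheory.Balaban1983to89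
open T4Continuum AveragingRT BlockAveraging BlockAveragingHaarAC BlockAveragingEMLHaarAC ExpMeanLog
open Summit.QuantumFields.YangMills.Theorems.BlockAvgCorrector (stokesConst stokesConst_nonneg emlWeight_pos emlWeight_le_one)

variable {P : Params} {j : ℕ}

/-- **AGREEMENT PROPAGATES UP, OFF THE TOWER**: if `U′ = U` at every bond outside `β(S)` for a set `S` of coarse bonds, then `Ū′(c) = Ū(c)` for every `c ∉ S`
(locality of (0.4): the average at `c` sees the central bond of `c` and non-central bonds only). [cite: Balaban1987RG1, (0.4) p.253] -/
theorem avgFun_eq_of_agree_off_image [DecidableEq (PBond P j)] (hj : j + 1 ≤ P.m + P.K) (ℰ : LoopAverage (Matrix.specialUnitaryGroup (Fin 2) ℂ))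
    (U U' : GaugeField P j (Matrix.specialUnitaryGroup (Fin 2) ℂ)) (S : Set (PBond P (j + 1)))
    (hagree : ∀ b : PBond P j, b ∉ centralBond '' S → U' b = U b) :
    ∀ c : PBond P (j + 1), c ∉ S → avgFun ℰ U' c = avgFun ℰ U c := by
  intro c hc
  have hoff : ∀ b : PBond P j, (∀ c' : PBond P (j + 1), centralBond c' ≠ b) → U' b = U b :=
    fun b hb => hagree b fun ⟨c', _, hc'⟩ => hb c' hc'
  have hcen : U' (centralBond c) = U (centralBond c) :=
    hagree _ fun ⟨c', hc'S, hc'⟩ => hc ((centralBond_injective hj hc') ▸ hc'S)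
  rw [avgFun_eq_avgFun_update_of_agree hj ℰ U U' c hoff, hcen, update_eq_self]

/-- **THE k-FOLD (0.4)-FIBRE IS A GRAPH OVER THE BONDS OUTSIDE THE ITERATED CENTRAL BONDS.**  Let `t, ρ ≥ 0` with
`stokesConst·(t + 4ρ) + ρ ≤ min(1/24, |I|⁻¹/148)`.  For every `n ≤ m + K`, every tower `T_i` with `T_i ⊆ β(T_{i+1})` for `i < n`, and all finest-lattice `SU(2)`
fields `U, U′` with `Ū^{(i)}` `t`-small, `Ū′^{(i)}` within `ρ` of `Ū^{(i)}` on the central bonds (`i < n`), `U′ = U` off `T₀`, and `Ū′^{(n)} = Ū^{(n)}`:  `U′ = U`.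
[cite: Balaban1985Variational, (47) p.287; Balaban1987RG1, (0.11) p.253] -/
theorem eq_of_iter_eq_of_agree {t ρ : ℝ} (ht : 0 ≤ t) (hρ : 0 ≤ ρ)
    (h24 : stokesConst P * (t + 4 * ρ) + ρ ≤ 1 / 24) (hκ : 148 * (stokesConst P * (t + 4 * ρ) + ρ) ≤ emlWeight P) :
    ∀ n : ℕ, n ≤ P.m + P.K →
    ∀ T : (i : ℕ) → Set (PBond P i), (∀ i, i < n → T i ⊆ centralBond '' T (i + 1)) →
    ∀ U U' : GaugeField P 0 (Matrix.specialUnitaryGroup (Fin 2) ℂ),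
      (∀ i, i < n → PlaqSmall t (Averaging.iter (fun i => blockAvg (P := P) (j := i) (expMeanLogSU (n := Fin 2))) i U)) →
      (∀ i, i < n → ∀ c : PBond P (i + 1),
        ‖((Averaging.iter (fun i => blockAvg (P := P) (j := i) (expMeanLogSU (n := Fin 2))) i U' (centralBond c) :
            Matrix.specialUnitaryGroup (Fin 2) ℂ) : Matrix (Fin 2) (Fin 2) ℂ) -
          (Averaging.iter (fun i => blockAvg (P := P) (j := i) (expMeanLogSU (n := Fin 2))) i U (centralBond c) : Matrix (Fin 2) (Fin 2) ℂ)‖ ≤ ρ) →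
      (∀ b : PBond P 0, b ∉ T 0 → U' b = U b) →
      Averaging.iter (fun i => blockAvg (P := P) (j := i) (expMeanLogSU (n := Fin 2))) n U' =
        Averaging.iter (fun i => blockAvg (P := P) (j := i) (expMeanLogSU (n := Fin 2))) n U →
      U' = U := by
  classical
  intro n hn T hT U U' hsm hclose hagree htop
  -- UP: agreement off the tower at every level
  have hup : ∀ i, i ≤ n → ∀ c : PBond P i, c ∉ T i →
      Averaging.iter (fun i => blockAvg (P := P) (j := i) (expMeanLogSU (n := Fin 2))) i U' c =
        Averaging.iter (fun i => blockAvg (P := P) (j := i) (expMeanLogSU (n := Fin 2))) i U c := by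
    intro i
    induction i with
    | zero =>
      intro _ c hc
      rw [iter_zero_apply, iter_zero_apply]
      exact hagree c hc
    | succ i ih =>
      intro hi c hc
      rw [iter_succ_eq_avgFun, iter_succ_eq_avgFun]
      have hi' : i < n := Nat.lt_of_succ_le hi
      refine avgFun_eq_of_agree_off_image (by omega) _ _ _ (T (i + 1)) (fun b hb => ih hi'.le b fun hbT => hb (hT i hi' hbT)) c hc
  -- DOWN: equality from the top, one step at a time
  have hdown : ∀ d l : ℕ, l + d = n →
      Averaging.iter (fun i => blockAvg (P := P) (j := i) (expMeanLogSU (n := Fin 2))) l U' =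
        Averaging.iter (fun i => blockAvg (P := P) (j := i) (expMeanLogSU (n := Fin 2))) l U := by
    intro d
    induction d with
    | zero =>
      intro l hl
      rw [add_zero] at hl
      subst hl
      exact htop
    | succ d ih =>
      intro l hl
      have hl1 : l + 1 + d = n := by omega
      have hln : l < n := by omega
      have h1 := ih (l + 1) hl1
      rw [iter_succ_eq_avgFun, iter_succ_eq_avgFun] at h1
      refine eq_of_avgFun_eq_of_agree (by omega) ht hρ h24 hκ _ _ (hsm l hln) (fun b hb => ?_) (hclose l hln) h1
      -- a non-central bond lies outside `T l ⊆ β(T (l+1))`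
      exact hup l hln.le b fun hbT => by
        obtain ⟨c', _, hc'⟩ := hT l hln hbT
        exact hb c' hc'
  have h0 := hdown n 0 (zero_add n)
  rw [iter_zero_apply, iter_zero_apply] at h0
  exact h0

end Summit.QuantumFields.YangMills.Theorems.Prop8Criticality

end
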